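import Summits.ResolutionOfSingularities.ResolutionOfSingularities.Theorems.WeightedInvariantJFlatEssSmoothAssembly
import Summits.ResolutionOfSingularities.ResolutionOfSingularities.Theorems.WeightedInvariantIotaOrderStratDimTwo
import HarnessLib

/-!
# (c11)≤3 for the flat centre filtration `J₃ᵗ = Iota3.jFlatT`, PART 5 — the POINT BRANCH at a CROSSING point (ε = 1) is
# `jContact` at equal dimension, which commutes with `φ` as soon as the terminal contact LEVEL does; refined assembly
# (door `HypersurfaceCentreConstruction`, stmt-ResolutionOfSingularities-19897; P3 rung clause (c11)≤3, J-half of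
# `IotaJEssSmoothCompatibleLE 3 p Iota3.iotaFlatT Iota3.jFlatT`; ORDER (o53) of res-L1-w43-plan-1, hand res-L1-w43-stub-3)

Topic: `Summits/ResolutionOfSingularities/ResolutionOfSingularities/Theorems`. Helper for the door item
`HypersurfaceCentreConstruction` (stmt-ResolutionOfSingularities-19897, route `WeightedInvariant`), line `local-engine`
(L W4.3), def-free.  PART 4 (`jFlatT_map`) left the equal-dimension-3 point branch as ONE hypothesis `hpt` on the ε-switched
core `jFlatCoreE`.  THIS FILE splits it along ε and removes everything dimension-two from the crossing half:

* §1 `iotaEps_eq_zero_of_isMonomialType`, `not_isMonomialType_of_iotaEps_eq_one` — a non-unit equation of monomial type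
  `v g^n` has the regular divisor `(g)` as its equimultiple locus (res-type-073 `strat_of_eq_unit_mul_pow` /
  005 `topStratum_iotaOrd_of_eq_unit_mul_pow`), so `ε = 0`; at a CROSSING point (`ε = 1`) the equation is never of monomial type.
* §2 **`jContact_map_of_bMax_eq`** — DIMENSION-FREE form of res-type-078's `jContactLocal_map_of_not_isMonomialType` (p520664):
  along `φ : S → S'` local, formally smooth, essentially of finite type between regular local rings with `𝔪_S S' = 𝔪_{S'}`, for
  `f ∈ 𝔪 ∖ 0` not of monomial type on either side, `bMax (φ f) = bMax f` ALONE gives `jContact S' (φ f) m = (jContact S f m) S'`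
  (C2 canonicity `contactFiltration_eq_of_mem`, p511384, is dimension-free; the two dimension-two inputs of p520664 were exactly
  `bMax_map_eq` and `isMonomialType_of_map`).
* §3 `jFlatCoreE_map_of_iotaEps_eq_one` — at `ε = 1` both cores are `jContact` (`ε` is preserved, `iotaEps_essSmooth_eq`), so the
  point branch follows from the LEVEL EQUALITY `bMax (φ f) = bMax f`; `jFlatCoreE_map_of_iotaEps_eq_zero` — at `ε = 0` and
  dimension `3` both cores are `jSigmaPt`.
* §4 **`jFlatT_map_of_bMax_of_sigma`** — PART 4's assembly with `hpt` replaced by the two NAMED residuals: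
  **GAP 1′** `hB : 𝔪_S S' = 𝔪' → dim S = 3 → ε = 1 → bMax (φ f) = bMax f` (= «reached contact levels DESCEND along φ at equal
  dimension three», the dimension-3 analogue of 078/070's `EssSmoothLevels.reaches_succ_of_map_reaches_succ`, Hironaka's vertex
  preparation in coordinates `(x₁, x₂, y)`) and **GAP 2** `hσ : 𝔪_S S' = 𝔪' → dim S = 3 → ε = 0 → jSigmaPt S' (φ f) m =
  (jSigmaPt S f m) S'` (the σ-flag point centre; after res-type-057's (c11σ)).  So the J-half of (c11)≤3 for
  `(iotaFlatT, jFlatT)` = ⟨(c11τ)≤3, GAP 1′, GAP 2⟩, each a single named statement.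

[OURS · L1 W4.3 · (o53)]  Replaces the role of NO printed item; NOT a statement of the manuscript
[claim: Hironaka2017, status: under-review]. AI work, weaker than expert review.  Pure commutative algebra; no named facts.

## References

* H. Hironaka, *Characteristic polyhedra of singularities*, J. Math. Kyoto Univ. 7 (1967) 251–293. [Hironaka1967]
* H. Matsumura, *Commutative Ring Theory* (1987), Thm. 14.3, 23.7. [Matsumura1987]
-/

noncomputable section

open IsLocalRing Literature.AlgebraicGeometry.Resolution
open Summit.ResolutionOfSingularities.ResolutionOfSingularities.Cruxes.HypersurfaceCentreConstruction.LocalEngine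
open Summit.ResolutionOfSingularities.ResolutionOfSingularities.Cruxes.HypersurfaceCentreConstruction.LocalEngine.Iota3

set_option linter.dupNamespace false -- mandated namespace of this single-conjunct summit

namespace Summit.ResolutionOfSingularities.ResolutionOfSingularities.Theorems

namespace JFlatEssSmooth

open ContactCylinder
open IotaOrderEssSmooth (mem_maximalIdeal_pow_iff_of_formallySmooth adicOrder_algebraMap_eq_of_formallySmooth)

/-! ## §1 At a crossing point the equation is not of monomial type -/

/-- A non-unit equation of monomial type has `ε = 0`: for `f = v g^n`, `n ≥ 1`, `g ∈ 𝔪 ∖ 𝔪²`, the equimultiple locus is the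
regular divisor `V(g)`. [OURS] -/
theorem iotaEps_eq_zero_of_isMonomialType (R : Type) [CommRing R] [IsRegularLocalRing R] {f : R} (hfu : ¬ IsUnit f)
    (hm : IsMonomialType f) : iotaEps R f = 0 := by
  obtain ⟨v, g, n, hv, hg, hg2, rfl⟩ := hm
  have hn : 0 < n := by
    rcases Nat.eq_zero_or_pos n with rfl | h
    · exact absurd (by rw [pow_zero, mul_one]; exact hv) hfu
    · exact h
  obtain ⟨hP, hreg, -, -⟩ := IotaOrderStrat.strat_of_eq_unit_mul_pow hv hg hg2 hn rfl
  rw [iotaEps_eq_zero_iff]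
  exact ⟨Ideal.span {g}, hP, hreg, topStratum_iotaOrd_of_eq_unit_mul_pow hv hg hg2 hn rfl⟩

/-- **At a crossing point (`ε = 1`) the equation is not of monomial type.** [OURS] -/
theorem not_isMonomialType_of_iotaEps_eq_one (R : Type) [CommRing R] [IsRegularLocalRing R] {f : R}
    (hε : iotaEps R f = 1) : ¬ IsMonomialType f := by
  intro hm
  by_cases hfu : IsUnit f
  · rw [iotaEps_of_isUnit hfu] at hε
    exact zero_ne_one hε
  · rw [iotaEps_eq_zero_of_isMonomialType R hfu hm] at hε
    exact zero_ne_one hε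

/-- At a crossing point the equation is a non-zero non-unit. [OURS] -/
theorem ne_zero_and_not_isUnit_of_iotaEps_eq_one (R : Type) [CommRing R] [IsRegularLocalRing R] {f : R}
    (hε : iotaEps R f = 1) : f ≠ 0 ∧ ¬ IsUnit f := by
  constructor
  · rintro rfl
    rw [iotaEps_zero] at hε
    exact zero_ne_one hε
  · intro hfu
    rw [iotaEps_of_isUnit hfu] at hε
    exact zero_ne_one hε

/-! ## §2 `jContact` commutes with `φ` as soon as the terminal level does (dimension-free) -/

section Contact

variable {S S' : Type} [CommRing S] [CommRing S'] [IsRegularLocalRing S] [IsRegularLocalRing S'] [Algebra S S']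
  [IsLocalHom (algebraMap S S')] [Algebra.FormallySmooth S S'] [Algebra.EssFiniteType S S']

/-- **`jContact` COMMUTES WITH AN ESSENTIALLY SMOOTH LOCAL HOMOMORPHISM AS SOON AS THE TERMINAL LEVEL DOES** (dimension-free
form of res-type-078's `jContactLocal_map_of_not_isMonomialType`, p520664): `φ : S → S'` local, formally smooth, essentially of
finite type between regular local rings with `𝔪_S S' = 𝔪_{S'}`; `f ∈ 𝔪 ∖ 0` not of monomial type in `S`, `φ f` not of monomial
type in `S'`, and `bMax (φ f) = bMax f`.  Then `jContact S' (φ f) m = (jContact S f m) S'` for every `m`: at `B ≤ 1` both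
are `𝔪^m`; at `B ≥ 2` a maximiser of `S` maps to a maximiser of `S'`, and every maximiser of `S'` defines the same filtration
(C2 canonicity `contactFiltration_eq_of_mem`, p511384, any dimension). [cite: Hironaka1967, Thm. (well-preparedness)] -/
theorem jContact_map_of_bMax_eq (h𝔪 : (maximalIdeal S).map (algebraMap S S') = maximalIdeal S') {f : S} (hf0 : f ≠ 0)
    (hfu : ¬ IsUnit f) (hnm : ¬ IsMonomialType f) (hnm' : ¬ IsMonomialType (algebraMap S S' f))
    (hB : bMax (algebraMap S S' f) = bMax f) (m : ℕ) :
    jContact S' (algebraMap S S' f) m = (jContact S f m).map (algebraMap S S') := by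
  classical
  have hfm : f ∈ maximalIdeal S := (IsLocalRing.mem_maximalIdeal f).mpr hfu
  have hf0' : algebraMap S S' f ≠ 0 := fun h =>
    hf0 (EssSmoothDescent.algebraMap_injective (S := S) (S' := S') (by rw [h, map_zero]))
  have hfu' : ¬ IsUnit (algebraMap S S' f) := fun h => hfu ((isUnit_map_iff _ f).mp h)
  obtain ⟨hν, -, hford⟩ := EssSmoothLevels.adicOrder_toNat_spec hf0 hfm
  set ν := (adicOrder f).toNat with hνdef
  have hford' : algebraMap S S' f ∉ maximalIdeal S' ^ (ν + 1) := fun h =>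
    hford ((mem_maximalIdeal_pow_iff_of_formallySmooth S S' _ f).mpr h)
  rw [jContact_eq, jContact_eq, jContactLocal_of_not_isMonomialType hf0' hfu' hnm',
    jContactLocal_of_not_isMonomialType hf0 hfu hnm, adicOrder_algebraMap_eq_of_formallySmooth S S' f, hB, ← hνdef]
  set B := bMax f with hBdef
  rw [Ideal.map_sup, Ideal.map_pow, h𝔪, Ideal.map_iSup]
  simp_rw [Ideal.map_iSup, EssSmoothLevels.map_contactFiltration h𝔪]
  refine le_antisymm (sup_le le_sup_left (iSup₂_le fun g' hg' => ?_)) (sup_le le_sup_left (iSup₂_le fun g hg => ?_))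
  · -- a maximiser `g'` of `S'`
    obtain ⟨hg'm, hg'2, hg'f⟩ := hg'
    rcases Nat.lt_or_ge B 2 with hB2 | hB2
    · rcases (show B = 0 ∨ B = 1 by omega) with hB0 | hB1
      · rw [hB0, contactFiltration_zero_weight]
        exact le_sup_left
      · rw [hB1, contactFiltration_one_weight hg'm]
        exact le_sup_left
    · -- `B ≥ 2`: a maximiser of `S` exists, and C2 identifies the two filtrations in `S'`
      have hmem : B ∈ {b : ℕ | 1 ≤ b ∧ Reaches f ν b} := by
        have hB' : sSup {b : ℕ | 1 ≤ b ∧ Reaches f ν b} = B := by rw [hBdef, bMax_def]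
        have hne : {b : ℕ | 1 ≤ b ∧ Reaches f ν b}.Nonempty := by
          by_contra h
          rw [Set.not_nonempty_iff_eq_empty] at h
          rw [h, csSup_empty] at hB'
          exact absurd hB' (by change ¬ (0 = B); omega)
        have hbdd : BddAbove {b : ℕ | 1 ≤ b ∧ Reaches f ν b} := by
          by_contra h
          rw [csSup_of_not_bddAbove h, csSup_empty] at hB'
          exact absurd hB' (by change ¬ (0 = B); omega)
        rw [← hB']
        exact Nat.sSup_mem hne hbdd
      obtain ⟨-, g₀, hg₀, hg₀2, hfg₀⟩ := hmem
      have hφg₀ : algebraMap S S' g₀ ∈ maximalIdeal S' := map_nonunit _ _ hg₀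
      have hφg₀2 : algebraMap S S' g₀ ∉ maximalIdeal S' ^ 2 := fun h =>
        hg₀2 ((mem_maximalIdeal_pow_iff_of_formallySmooth S S' 2 g₀).mpr h)
      have hφf : algebraMap S S' f ∈ contactFiltration (algebraMap S S' g₀) B (B * ν) :=
        (EssSmoothLevels.algebraMap_mem_contactFiltration_iff h𝔪 f g₀ B _).mpr hfg₀
      have heq : contactFiltration g' B m = contactFiltration (algebraMap S S' g₀) B m :=
        ContactFiltration.contactFiltration_eq_of_mem hg'm hg'2 hφg₀ hφg₀2 hB2 hν hford' hg'f hφf m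
      rw [heq]
      exact le_sup_of_le_right (le_iSup₂_of_le g₀ ⟨hg₀, hg₀2, hfg₀⟩ le_rfl)
  · -- a maximiser `g` of `S` extends to a maximiser `φ g` of `S'`
    obtain ⟨hgm, hg2, hgf⟩ := hg
    exact le_sup_of_le_right (le_iSup₂_of_le (algebraMap S S' g)
      ⟨map_nonunit _ _ hgm, fun h => hg2 ((mem_maximalIdeal_pow_iff_of_formallySmooth S S' 2 g).mpr h),
        (EssSmoothLevels.algebraMap_mem_contactFiltration_iff h𝔪 f g B _).mpr hgf⟩ le_rfl)

/-! ## §3 The ε-switched core at a point-centre position -/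

/-- **At a CROSSING point (`ε = 1`) the ε-switched core commutes with `φ` as soon as the terminal level does**: both cores are
`jContact` (`ε (φ f) = ε f = 1`, res-type-013's `iotaEps_essSmooth_eq`), the equation is not of monomial type on either side
(§1), and §2 applies. [OURS · L1 W4.3 · (o53)] -/
theorem jFlatCoreE_map_of_iotaEps_eq_one (h𝔪 : (maximalIdeal S).map (algebraMap S S') = maximalIdeal S') {f : S}
    (hε : iotaEps S f = 1) (hB : bMax (algebraMap S S' f) = bMax f) (m : ℕ) :
    jFlatCoreE S' (algebraMap S S' f) m = (jFlatCoreE S f m).map (algebraMap S S') := by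
  have hε' : iotaEps S' (algebraMap S S' f) = 1 := by rw [iotaEps_essSmooth_eq S S' f, hε]
  obtain ⟨hf0, hfu⟩ := ne_zero_and_not_isUnit_of_iotaEps_eq_one S hε
  rw [jFlatCoreE_of_pos S' (Or.inr hε'), jFlatCoreE_of_pos S (Or.inr hε)]
  exact jContact_map_of_bMax_eq h𝔪 hf0 hfu (not_isMonomialType_of_iotaEps_eq_one S hε)
    (not_isMonomialType_of_iotaEps_eq_one S' hε') hB m

/-- **At an ε = 0 point of dimension three both ε-switched cores are `jSigmaPt`** (`dim S = dim S' = 3`, `ε` preserved), so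
the core commutes with `φ` as soon as `jSigmaPt` does. [OURS · L1 W4.3 · (o53)] -/
theorem jFlatCoreE_map_of_iotaEps_eq_zero (hdim : ringKrullDim S = (3 : ℕ)) (hdim' : ringKrullDim S' = (3 : ℕ)) {f : S}
    (hε : iotaEps S f = 0)
    (hσ : ∀ m : ℕ, jSigmaPt S' (algebraMap S S' f) m = (jSigmaPt S f m).map (algebraMap S S')) (m : ℕ) :
    jFlatCoreE S' (algebraMap S S' f) m = (jFlatCoreE S f m).map (algebraMap S S') := by
  have hε' : iotaEps S' (algebraMap S S' f) = 0 := by rw [iotaEps_essSmooth_eq S S' f, hε]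
  have h3 : ¬ ringKrullDim S ≤ 2 := not_ringKrullDim_le_two_of_eq_three (by rw [hdim]; rfl)
  have h3' : ¬ ringKrullDim S' ≤ 2 := not_ringKrullDim_le_two_of_eq_three (by rw [hdim']; rfl)
  rw [jFlatCoreE_of_not_dim_le_two_of_eps_ne_one S' h3' (by rw [hε']; exact zero_ne_one),
    jFlatCoreE_of_not_dim_le_two_of_eps_ne_one S h3 (by rw [hε]; exact zero_ne_one)]
  exact hσ m

end Contact

/-! ## §4 The refined assembly -/

section Assembly

variable (S S' : Type) [CommRing S] [IsRegularLocalRing S] [CommRing S'] [IsRegularLocalRing S'] [Algebra S S']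
  [IsLocalHom (algebraMap S S')] [Algebra.FormallySmooth S S'] [Algebra.EssFiniteType S S']

/-- **(c11)≤3, J-HALF, FOR `J₃ᵗ = Iota3.jFlatT`, MODULO ⟨(c11τ)≤3, GAP 1′, GAP 2⟩.**  `φ : S → S'` local, formally smooth,
essentially of finite type between regular local rings, `dim S' ≤ 3`, `f ∈ S`.  ASSUME (τ) the tie letter is compatible with `φ`
at the closed point and at every prime of `S'` (res-type-013's (c11τ)≤3); (GAP 1′) at a crossing point of equal dimension three
the terminal contact LEVEL of `f` is that of `φ f`; (GAP 2) at an ε = 0 point of equal dimension three `jSigmaPt` commutes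
with `φ` at `f`.  THEN `jFlatT S' (φ f) m = (jFlatT S f m) S'` for every `m`. [OURS · L1 W4.3 · (o53)] -/
theorem jFlatT_map_of_bMax_of_sigma (hdimS' : ringKrullDim S' ≤ 3) (f : S)
    (hτ : iotaTau S' (algebraMap S S' f) = iotaTau S f)
    (hτpt : ∀ (𝔮' : Ideal S') [𝔮'.IsPrime], iotaTau (Localization.AtPrime 𝔮') (algebraMap S (Localization.AtPrime 𝔮') f) =
      iotaTau (Localization.AtPrime (𝔮'.comap (algebraMap S S')))
        (algebraMap S (Localization.AtPrime (𝔮'.comap (algebraMap S S'))) f))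
    (hB : (maximalIdeal S).map (algebraMap S S') = maximalIdeal S' → ringKrullDim S = (3 : ℕ) → iotaEps S f = 1 →
      bMax (algebraMap S S' f) = bMax f)
    (hσ : (maximalIdeal S).map (algebraMap S S') = maximalIdeal S' → ringKrullDim S = (3 : ℕ) → iotaEps S f = 0 →
      ∀ m : ℕ, jSigmaPt S' (algebraMap S S' f) m = (jSigmaPt S f m).map (algebraMap S S'))
    (m : ℕ) :
    jFlatT S' (algebraMap S S' f) m = (jFlatT S f m).map (algebraMap S S') := by
  refine jFlatT_map S S' hdimS' f hτ hτpt (fun h𝔪 hdim m => ?_) m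
  have hdim' : ringKrullDim S' = (3 : ℕ) :=
    le_antisymm (hdimS'.trans_eq (by rfl)) (hdim ▸ EssSmoothLE2.ringKrullDim_le S S')
  by_cases hε : iotaEps S f = 1
  · exact jFlatCoreE_map_of_iotaEps_eq_one h𝔪 hε (hB h𝔪 hdim hε) m
  · have hε0 : iotaEps S f = 0 := by
      rcases (iotaEps_le_one S f).lt_or_eq with h | h
      · exact Order.lt_one_iff.mp h
      · exact absurd h hε
    exact jFlatCoreE_map_of_iotaEps_eq_zero hdim hdim' hε0 (hσ h𝔪 hdim hε0) m

end Assembly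

end JFlatEssSmooth

end Summit.ResolutionOfSingularities.ResolutionOfSingularities.Theorems

end
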